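import Summits.CriticalPhenomena.PercolationContinuityZ3.Theorems.PercNearOneGluingNoHeavyLowerTailGluedSetExchange
import Summits.CriticalPhenomena.PercolationContinuityZ3.Theorems.PercNearOneGluingNoHeavyLowerTailAttachedLightness
import HarnessLib

/-!
# `NoHeavyLowerTail` (stmt-CriticalPhenomena-4575) — the SET-GLUING TOP (less light-prone comparison relay)

Support file (prover `prim-hp-8`, PL programme; `--supports stmt-CriticalPhenomena-4575`).  No definitions, no named facts, no sorries.

Setting (as in `…GluedSetExchange`): weights `v` on `Fin n` deterministic at a vertex `o` — every non-loop pair at `o` has weight `0` or `1`,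
so `o` is GLUED to the set `U = {y : v s(o,y) = 1}` and detached from the rest; `u` = the weights with the pairs at `o` switched off (the
unglued graph `K`).  For a vertex `y`, `R_y = {|A ∩ C(y)| ≤ j}` and the LOSS of `y` caused by the gluing is `μ_u(R_y) − μ_v(R_y)`.

* `setGluing_loss_le` — **set-gluing TOP.**  If `x` is glued (`v s(o,x) = 1`), `z` is not (`v s(o,z) = 0`) and `z` is at most as
  light-prone as `x` in the unglued graph (`μ_u(R_z) ≤ μ_u(R_x)`), then the gluing costs `x` at least as much lightness as it costs `z`:
  `μ_u(R_z) − μ_v(R_z) ≤ μ_u(R_x) − μ_v(R_x)`.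
  Proof (memo PROOF-COIN-REDUCTION.md §14): unglue (`CutObserver.measureReal_preimage_avoid`, `reachable_from_obs_iff'`): on `{z ↮ o}`
  nothing changes for `z`; on `{z ↔ o}` the loneliness of `z` is that of `x`; the glued cluster of `x` contains its unglued cluster.  This leaves
  `μ_u(z ↔ U, R_z) ≤ μ_u(z ↔ U, R_x)`, which is `SetGluing.attached_lonely_le_of_le'` (BHK 2006 Thm 1.5).
  With `x` the most light-prone relay of a relay set `X = U` this is one half of Conjecture S on the star stratum (pairs of glued relay sets);
  census 0 / 81 945 (kit j067900, sgt).  [cite: VandenbergHaggstromKahn2005, Thm. 1.5 (p. 7) — via `attached_lonely_le_of_le'`]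
-/

noncomputable section

namespace Summit.CriticalPhenomena.PercolationContinuityZ3.Theorems

namespace SetGluing

open MeasureTheory Set Literature.Probability.LatticeModels Literature.Probability.Percolation
open scoped Classical BigOperators

variable {n : ℕ}

/-- **Set-gluing TOP (less light-prone comparison vertex).**  `v` deterministic at `o`, `x ≠ o` glued to `o`, `z ≠ o` not glued to `o`,
`u` = `v` with the pairs at `o` switched off, and `μ_u(R_z) ≤ μ_u(R_x)`.  Then `μ_u(R_z) − μ_v(R_z) ≤ μ_u(R_x) − μ_v(R_x)`: gluing the set
`{y : v s(o,y) = 1}` together (through `o`) costs its member `x` at least as much lightness as it costs the less light-prone outsider `z`.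
[cite: VandenbergHaggstromKahn2005, Thm. 1.5 (p. 7) — via `attached_lonely_le_of_le'`] -/
theorem setGluing_loss_le (v : Sym2 (Fin n) → unitInterval) (A : Finset (Fin n)) (j : ℕ) {o x z : Fin n}
    (hxo : x ≠ o) (hzo : z ≠ o) (hvx : v s(o, x) = 1) (hvz : v s(o, z) = 0)
    (hdet : ∀ y : Fin n, y ≠ o → v s(o, y) = 0 ∨ v s(o, y) = 1)
    (hle : (prodBernoulli fun e : Sym2 (Fin n) => if e ∈ {e : Sym2 (Fin n) | o ∉ e} then v e else 0).real
        {ω : BondConfig (Fin n) | (A.filter fun a => ω ∈ openConn z a).card ≤ j} ≤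
      (prodBernoulli fun e : Sym2 (Fin n) => if e ∈ {e : Sym2 (Fin n) | o ∉ e} then v e else 0).real
        {ω : BondConfig (Fin n) | (A.filter fun a => ω ∈ openConn x a).card ≤ j}) :
    (prodBernoulli fun e : Sym2 (Fin n) => if e ∈ {e : Sym2 (Fin n) | o ∉ e} then v e else 0).real
        {ω : BondConfig (Fin n) | (A.filter fun a => ω ∈ openConn z a).card ≤ j} -
      (prodBernoulli v).real {ω : BondConfig (Fin n) | (A.filter fun a => ω ∈ openConn z a).card ≤ j} ≤
    (prodBernoulli fun e : Sym2 (Fin n) => if e ∈ {e : Sym2 (Fin n) | o ∉ e} then v e else 0).real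
        {ω : BondConfig (Fin n) | (A.filter fun a => ω ∈ openConn x a).card ≤ j} -
      (prodBernoulli v).real {ω : BondConfig (Fin n) | (A.filter fun a => ω ∈ openConn x a).card ≤ j} := by
  set μ := prodBernoulli v with hμ
  set u : Sym2 (Fin n) → unitInterval := fun e => if e ∈ {e : Sym2 (Fin n) | o ∉ e} then v e else 0 with hu
  set μu := prodBernoulli u with hμu
  set Rz : Set (BondConfig (Fin n)) := {ω | (A.filter fun a => ω ∈ openConn z a).card ≤ j} with hRz
  set Rx : Set (BondConfig (Fin n)) := {ω | (A.filter fun a => ω ∈ openConn x a).card ≤ j} with hRx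
  set D : Set (BondConfig (Fin n)) := (openConn z o)ᶜ with hD
  have hmeas : ∀ S : Set (BondConfig (Fin n)), MeasurableSet S := fun S => (Set.toFinite S).measurableSet
  have hzx : z ≠ x := by
    intro h; rw [h] at hvz; rw [hvz] at hvx; exact zero_ne_one hvx
  -- the glued set and the full-measure event fixing the edges at o
  set U : Finset (Fin n) := Finset.univ.filter fun y => y ≠ o ∧ v s(o, y) = 1 with hUdef
  have hoU : o ∉ U := fun h => (Finset.mem_filter.1 h).2.1 rfl
  have hxU : x ∈ U := Finset.mem_filter.2 ⟨Finset.mem_univ _, hxo, hvx⟩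
  have hzU : z ∉ U := by
    intro h; have := (Finset.mem_filter.1 h).2.2; rw [hvz] at this; exact zero_ne_one this
  set G : Set (BondConfig (Fin n)) := {ω | ∀ y : Fin n, y ≠ o → (s(o, y) ∈ ω ↔ y ∈ U)} with hGdef
  have hGae : ∀ᵐ ω ∂μ, ω ∈ G := by
    have h : ∀ y : Fin n, ∀ᵐ ω ∂μ, y ≠ o → (s(o, y) ∈ ω ↔ y ∈ U) := by
      intro y
      by_cases hyo : y = o
      · exact Filter.Eventually.of_forall fun ω h => absurd hyo h
      rcases hdet y hyo with h0 | h1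
      · have hyU : y ∉ U := by
          intro h; have := (Finset.mem_filter.1 h).2.2; rw [h0] at this; exact zero_ne_one this
        filter_upwards [prodBernoulli_ae_notMem v h0] with ω hω
        exact fun _ => iff_of_false hω hyU
      · have hyU : y ∈ U := Finset.mem_filter.2 ⟨Finset.mem_univ _, hyo, h1⟩
        filter_upwards [prodBernoulli_ae_mem_of_eq_one v h1] with ω hω
        exact fun _ => iff_of_true hω hyU
    filter_upwards [ae_all_iff.2 h] with ω hω
    exact hω
  have hF1 : ∀ ω ∈ G, ∀ y : Fin n, y ≠ o →
      ((openGraph ω).Reachable o y ↔ ∃ y' ∈ U, (openGraph (ω ∩ {e | o ∉ e})).Reachable y' y) :=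
    fun ω hωG y hy => CoinReduction.reachable_from_obs_iff' ω U hoU hωG y hy
  have hF2 : ∀ ω : BondConfig (Fin n), ∀ a b : Fin n, ¬ (openGraph ω).Reachable a o →
      ((openGraph ω).Reachable a b ↔ (openGraph (ω ∩ {e | o ∉ e})).Reachable a b) :=
    fun ω a b hao => ⟨fun h => CutObserver.reachable_avoiding_of_not_reachable hao h,
      fun h => CutObserver.reachable_mono inter_subset_left h⟩
  -- the unglued events
  set P : Set (BondConfig (Fin n)) := ⋃ y ∈ U, (openConn z y : Set (BondConfig (Fin n))) with hP
  set N : Set (BondConfig (Fin n)) := Pᶜ with hN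
  -- (1) on G ∩ D (z not attached): R_z ω ↔ (ω' ∈ Rz ∩ N), ω' = ω minus the pairs at o
  have hS1 : ∀ ω ∈ G, (ω ∈ Rz ∩ D ↔ ω ∩ {e | o ∉ e} ∈ Rz ∩ N) := by
    intro ω hωG
    have hzo' : ¬ (openGraph ω).Reachable z o ↔ ω ∩ {e | o ∉ e} ∈ N := by
      simp only [hN, hP, mem_compl_iff, mem_iUnion, exists_prop, not_exists, not_and]
      constructor
      · intro hno y hyU hzy
        have hzy' : (openGraph (ω ∩ {e | o ∉ e})).Reachable z y := hzy
        exact hno (((hF1 ω hωG z hzo).2 ⟨y, hyU, hzy'.symm⟩).symm)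
      · intro hno hzo2
        obtain ⟨y, hyU, hyz⟩ := (hF1 ω hωG z hzo).1 hzo2.symm
        exact hno y hyU (hyz.symm : (openGraph (ω ∩ {e | o ∉ e})).Reachable z y)
    constructor
    · rintro ⟨hR, hDω⟩
      have hno : ¬ (openGraph ω).Reachable z o := hDω
      refine ⟨?_, hzo'.1 hno⟩
      simp only [hRz, mem_setOf_eq] at hR ⊢
      refine le_trans (le_of_eq ?_) hR
      apply congrArg Finset.card; apply Finset.filter_congr
      intro a _; exact (hF2 ω z a hno).symm
    · rintro ⟨hR, hNω⟩
      have hno : ¬ (openGraph ω).Reachable z o := hzo'.2 hNω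
      refine ⟨?_, hno⟩
      simp only [hRz, mem_setOf_eq] at hR ⊢
      refine le_trans (le_of_eq ?_) hR
      apply congrArg Finset.card; apply Finset.filter_congr
      intro a _; exact hF2 ω z a hno
  have e1 : μ.real (Rz ∩ D) = μu.real (Rz ∩ N) := by
    have h1 : μ.real (Rz ∩ D) = μ.real {ω : BondConfig (Fin n) | ω ∩ {e | o ∉ e} ∈ Rz ∩ N} := by
      refine measureReal_congr (hGae.mono fun ω hω => ?_)
      exact propext (hS1 ω hω)
    rw [h1]; exact CutObserver.measureReal_preimage_avoid v o (Rz ∩ N)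
  -- (2) on G ∩ Dᶜ (z attached to o): R_z ↔ R_x (x is glued to o)
  have hS2 : ∀ ω ∈ G, (ω ∈ Rz ∩ Dᶜ ↔ ω ∈ Rx ∩ Dᶜ) := by
    intro ω hωG
    have hox : (openGraph ω).Reachable o x := by
      have hadj : (openGraph ω).Adj o x := by
        rw [openGraph, SimpleGraph.fromEdgeSet_adj]
        exact ⟨(hωG x hxo).2 hxU, hxo.symm⟩
      exact hadj.reachable
    constructor
    · rintro ⟨hR, hE⟩
      have hzo2 : (openGraph ω).Reachable z o := by
        by_contra h; exact hE h
      refine ⟨?_, hE⟩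
      simp only [hRz, hRx, mem_setOf_eq] at hR ⊢
      refine le_trans (le_of_eq ?_) hR
      apply congrArg Finset.card; apply Finset.filter_congr
      intro a _
      change (openGraph ω).Reachable x a ↔ (openGraph ω).Reachable z a
      exact ⟨fun h => (hzo2.trans hox).trans h, fun h => (hox.symm.trans hzo2.symm).trans h⟩
    · rintro ⟨hR, hE⟩
      have hzo2 : (openGraph ω).Reachable z o := by
        by_contra h; exact hE h
      refine ⟨?_, hE⟩
      simp only [hRz, hRx, mem_setOf_eq] at hR ⊢
      refine le_trans (le_of_eq ?_) hR
      apply congrArg Finset.card; apply Finset.filter_congr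
      intro a _
      change (openGraph ω).Reachable z a ↔ (openGraph ω).Reachable x a
      exact ⟨fun h => (hox.symm.trans hzo2.symm).trans h, fun h => (hzo2.trans hox).trans h⟩
  have e2 : μ.real (Rz ∩ Dᶜ) = μ.real (Rx ∩ Dᶜ) := by
    refine measureReal_congr (hGae.mono fun ω hω => ?_)
    exact propext (hS2 ω hω)
  -- (3) on G ∩ D: R_x ω ⇒ ω' ∈ Rx ∩ N
  have hS3 : Rx ∩ D ∩ G ⊆ {ω : BondConfig (Fin n) | ω ∩ {e | o ∉ e} ∈ Rx ∩ N} := by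
    rintro ω ⟨⟨hR, hDω⟩, hωG⟩
    have hno : ¬ (openGraph ω).Reachable z o := hDω
    simp only [mem_setOf_eq, mem_inter_iff]
    constructor
    · simp only [hRx, mem_setOf_eq] at hR ⊢
      refine le_trans (Finset.card_le_card ?_) hR
      intro a ha
      simp only [Finset.mem_filter] at ha ⊢
      exact ⟨ha.1, CutObserver.reachable_mono inter_subset_left ha.2⟩
    · simp only [hN, hP, mem_compl_iff, mem_iUnion, exists_prop, not_exists, not_and]
      intro y hyU hzy
      have hzy' : (openGraph (ω ∩ {e | o ∉ e})).Reachable z y := hzy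
      exact hno (((hF1 ω hωG z hzo).2 ⟨y, hyU, hzy'.symm⟩).symm)
  have e3 : μ.real (Rx ∩ D) ≤ μu.real (Rx ∩ N) := by
    have h1 : μ.real (Rx ∩ D) = μ.real (Rx ∩ D ∩ G) := by
      refine measureReal_congr (hGae.mono fun ω hω => ?_)
      exact propext ⟨fun h => ⟨h, hω⟩, fun h => h.1⟩
    calc μ.real (Rx ∩ D) = μ.real (Rx ∩ D ∩ G) := h1
      _ ≤ μ.real {ω : BondConfig (Fin n) | ω ∩ {e | o ∉ e} ∈ Rx ∩ N} := measureReal_mono hS3 (measure_ne_top _ _)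
      _ = μu.real (Rx ∩ N) := CutObserver.measureReal_preimage_avoid v o (Rx ∩ N)
  -- (4) the attached-lightness comparison in the unglued graph: μu(Rz ∩ P) ≤ μu(Rx ∩ P)
  have e4 : μu.real (Rz ∩ P) ≤ μu.real (Rx ∩ P) := by
    have h := attached_lonely_le_of_le' u A j hzx (U.erase x) hle
    have hPe : ((openConn z x : Set (BondConfig (Fin n))) ∪ ⋃ y ∈ U.erase x, (openConn z y : Set (BondConfig (Fin n)))) = P := by
      ext ω
      simp only [hP, mem_union, mem_iUnion, exists_prop, Finset.mem_erase]
      constructor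
      · rintro (h1 | ⟨y, ⟨_, hyU⟩, hy⟩)
        · exact ⟨x, hxU, h1⟩
        · exact ⟨y, hyU, hy⟩
      · rintro ⟨y, hyU, hy⟩
        by_cases hyx : y = x
        · left; rw [← hyx]; exact hy
        · right; exact ⟨y, ⟨hyx, hyU⟩, hy⟩
    rw [hPe] at h
    rw [inter_comm Rz P, inter_comm Rx P]
    exact h
  -- splitting the four probabilities
  have hsplit : ∀ (ν : Measure (BondConfig (Fin n))) [IsFiniteMeasure ν] (S T : Set (BondConfig (Fin n))),
      ν.real S = ν.real (S ∩ T) + ν.real (S ∩ Tᶜ) := by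
    intro ν _ S T
    have hs : S = (S ∩ T) ∪ (S ∩ Tᶜ) := by
      ext ω; simp only [mem_inter_iff, mem_union, mem_compl_iff]; tauto
    have hd : Disjoint (S ∩ T) (S ∩ Tᶜ) := by
      rw [Set.disjoint_left]; rintro ω ⟨_, h1⟩ ⟨_, h2⟩; exact h2 h1
    have h := congrArg ν.real hs
    rw [measureReal_union hd (hmeas _)] at h
    exact h
  have sz : μ.real Rz = μ.real (Rz ∩ D) + μ.real (Rz ∩ Dᶜ) := hsplit μ Rz D
  have sx : μ.real Rx = μ.real (Rx ∩ D) + μ.real (Rx ∩ Dᶜ) := hsplit μ Rx D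
  have uz : μu.real Rz = μu.real (Rz ∩ P) + μu.real (Rz ∩ N) := hsplit μu Rz P
  have ux : μu.real Rx = μu.real (Rx ∩ P) + μu.real (Rx ∩ N) := hsplit μu Rx P
  change μu.real Rz - μ.real Rz ≤ μu.real Rx - μ.real Rx
  rw [sz, sx, uz, ux, e1, e2]
  linarith

end SetGluing

end Summit.CriticalPhenomena.PercolationContinuityZ3.Theorems

end
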